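import Summits.NavierStokesRegularity.NavierStokesRegularity.Theorems.CircuitTrace.Negative.LoadBearing
import HarnessLib.Audit

/-!
# Line `cold-gap-starvation` for crux `PerpetualPump.CircuitTrace` (stmt-NavierStokesRegularity-1836)

Skeleton (crux-plan, planner-cruxplan-stmt-NavierStokesRegularity-1836-cold-gap-starvation-0, 2026-08-16),
from crux idea card `Cruxes/CircuitTrace/Ideas/cold-gap-starvation.md` (ideator 1, round 1; triage r1-1/2/3:
PASS ×3, with the sharpenings "drop the ℓ³ pigeonhole and the slow/fast dichotomy", "take the valve packaging",
"state the pace theorem under the ℓ^∞ bound alone (SYNCHRONY) as a standalone lemma" — all acted on below).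
POSITIVE line. `CircuitTrace_of : CircuitTrace` (the four sorried stubs fed to the two sorry-free
compositions) concludes the route decl
`Summit.NavierStokesRegularity.NavierStokesRegularity.Theses.PerpetualPump.CircuitTrace` BY NAME — the unique
`#h21_check_skeleton` theorem (closed = false until the stubs land). Stub statements are plain `def … : Prop`.

## The line in one paragraph (critical units: `a_{i,n} = lam^{n/5}|X_{i,n}|`, clock of scale `n` = `lam^{4n/5}`)

VALVE LAW (card lever, = Tao's cyclic cancellation read at a cut): with offsets `S = {0,e₁,e₂,e₃}` the only
trilinear monomials crossing the cut `g | g+1` are `X_g X_g X_{g+1}`, so the energy of the block ABOVE `g`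
changes only by its own dissipation and by the flux `2 lam^g Σ coeff(i₁,i₂,i₃,e₃) X_{i₁,g}X_{i₂,g}X_{i₃,g+1}`,
which is QUADRATIC in the valve amplitude `a_g` (`ValveFlux`, stub S1). STARVATION: while the valve `g` is
`δ`-quiet and some scale above it is `δ`-active, the critical block energy `lam^{2(g+1)/5} E_{>g} ≤ C A²` burns
at rate `≥ δ²/2` per valve-clock unit, because the leak `2K m² lam^{-3/5} δ² a_{g+1}` through a quiet valve is
absorbed by `a_{g+1}`'s own dissipation once `δ ≤ δ₀(lam,m,coeff)` — so activity above a quiet valve lives at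
most `C A²/δ²` valve-clock units (`ValveBudget`, stub S3, the card's K1 budget with the triage's packaging).
ε-REGULARITY: a `δ₁`-quiet valve under a `δ₁`-quiet block keeps the block quiet and the weighted amplitudes
`lam^{4n}|X_n|` bounded (two discrete maximum principles + one Duhamel step: `QuietBlockRegular`, stub S2 =
card links (i)+(ii)). PACE THEOREM (proved here from S1–S3, `synchrony_of_parts`): in ANY blow-up with bounded
`ℓ^∞`-critical amplitude `sup a ≤ A`, EVERY large scale `g` is `δ`-active at some time within `D(A)` units of its
own clock before `T` (`Synchrony`) — for if `g` were quiet on its final window, either the block above it is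
quiet at some instant (S2 ⇒ regular) or it is active throughout (S3 ⇒ the window is shorter than it is).
This is the card's output `typeI_paced_fronts` in the sharpened every-large-scale, `ℓ^∞`-only form the three
triagers asked for (no pigeonhole, no slow/fast dichotomy: "policing" of the valve is free on the final
window), and it is the design constraint crux `CircuitPump` (#1834) must meet. ENDGAME (stub S4,
`SparseLateActivity`, the F1/`ℓ³` half supplied by the companion cards — `clock-discounted-trail-mass`'s
`TraceInequality → LateActivitySparse`, or `tilted-trace-gronwall`'s terminal trace): under the crux's
`ℓ³`-critical bound only finitely many scales are `δ`-active within `D` own-clock units of `T`. Pace says all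
large scales are; sparsity says almost none is; hence no blow-up: `circuitTrace_of_parts`.

## Registered stubs (4; `def … : Prop` statement + `theorem stub_… : … := by sorry`)

* `ValveFlux` / `stub_valveFlux` (S1, M–L; card K2 = Ideator3 `TriadFlux`) — derivative of the tail energy
  `Σ_{n>g}‖X_n‖²` on `(0,T)` = `−2·(tail dissipation) + 2·(valve flux)`; cyclic cancellation orbit by orbit
  (`trilinear_cancel` of the Disproof file, per base scale) + termwise differentiation of the series under the
  a-priori `H¹⁰` bound.
* `QuietBlockRegular` / `stub_quietBlockRegular` (S2, M; card links (i)+(ii) = Ideator3 `QuietBlockRegular`,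
  here under the `ℓ^∞` bound) — quiet valve + quiet block at one instant ⇒ the crux's conclusion.
* `ValveBudget` / `stub_valveBudget` (S3, M; card K1's budget (iii)+(v) in valve packaging = Ideator3
  `ValveBudget`, here under the `ℓ^∞` bound and GIVEN the valve-flux identity for the solution at hand
  (`HasValveFlux`, discharged by S1 in the composition)) — `δ² lam^{4g/5} (t₂ − t₁) ≤ C_b A²`.
* `SparseLateActivity` / `stub_sparseLateActivity` (S4, L, HARDEST; the `ℓ³` endgame of the companion cards
  = corollary of Ideator3 `LateActivitySparse`) — beyond some scale `g₀` no `δ`-exceedance occurs within `D`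
  own-clock units of `T`. The ONLY stub that uses the `ℓ³` hypothesis (all others are `ℓ^∞`-tier and hence
  consistent with the conjectured Type-I pump; cf. `CircuitTraceLinfty` expected FALSE).

Proved here (no stub): `Synchrony` from S1–S3 (`synchrony_of_parts`: window choice, policing-free dichotomy,
budget contradiction, `g₀` from `lam^{-4g/5} → 0`), the crux from `Synchrony` + S4 (`circuitTrace_of_parts`:
`ℓ³ ⇒ ℓ^∞` bound `A = max M 1`, one scale `g ≥ max g₀ g₀'`), and `CircuitTrace_of`. `lean check`: rc 0,
sorries = the 4 stubs; composition axioms standard.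

## Disproof / negatives / triage honoured

* `Disproof.lean` (cdisprove v2, 2026-08-16, NO KILL) and the landed `Negative/LoadBearing.lean` (imported):
  `circuitTrace_false_without_apriori` — any proof must use the a-priori `H¹⁰` bound: the line uses it in S1
  (termwise differentiation / summability of tail energy and dissipation), S2 (suprema over scales are maxima;
  Duhamel step) and S3 (through `HasValveFlux`); it is carried in `IsSol.apriori`. `circuitTraceWithoutL3_false`
  (mod `MaximalH10Solutions`) — the `ℓ³` bound must be used: it is, exactly once, in S4; S1–S3 and `Synchrony`
  are `ℓ^∞`-tier statements that hold for Tao's Thm 4.2 circuit too (vacuously: its `sup a` is unbounded) and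
  for the conjectured Type-I pump (non-vacuously: synchrony is what a DSS front does). No stub is an instance of
  `CircuitTraceWithoutApriori`, `CircuitTraceWithoutL3` or `CircuitTraceLinfty`. The Disproof's structural facts
  are the line's stubs: F2 funding = S1+S3, F3 ε-regularity = S2, F1 one-sided coupling = inside S4.
* `ledger negatives --problem NavierStokesRegularity`: 2 entries (stmt-4055, stmt-0154), PDE-level, unrelated.
* Triage: r1-2 "pigeonhole redundant, pace under ℓ^∞ alone" → `Synchrony` has hypothesis `SupCritBound` only;
  r1-1/r1-3 "valve packaging / keep the valve law, drop the dichotomy" → S1/S3 are `TriadFlux`/`ValveBudget`-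
  shaped, the only case split left is "block above the quiet valve: quiet at some instant, or active throughout";
  r1-1 "state SYNCHRONY as its own lemma" → `Synchrony` is a named `def` with a sorry-free proof from S1–S3;
  r1-3 "fix one amplitude convention" → per-mode amplitudes `amp lam X i n t = lam^{n/5}|X_{i,n}(t)|` throughout;
  m = 0 / A < 0 / M < 0 corners: every stub is true or vacuous there (checked by hand, see the line card).
-/

set_option linter.dupNamespace false

noncomputable section

open Finset Real Set

namespace Summit.NavierStokesRegularity.NavierStokesRegularity.Cruxes.CircuitTrace.ColdGapStarvation

open Summit.NavierStokesRegularity.NavierStokesRegularity.Theses.PerpetualPump (CircuitTrace)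
open Summit.NavierStokesRegularity.NavierStokesRegularity.Theorems.CircuitTrace.Negative
  (circuitRHS IsSymm IsCyclic CircuitTrace' circuitTrace_iff)

/-! ## Vocabulary (all over the crux's own data `lam, m, coeff, T, X`) -/

/-- The solution hypotheses of the crux on `[0,T)`, bundled: continuity on `[0,T)`, Tao's circuit ODE (4.3)
(`circuitRHS`, definitionally the crux's inlined `F`) on `(0,T)`, no modes below scale `0`, and the a-priori
`H¹⁰` bound `sup lam^{4n}|X_{i,n}| < ∞` on every `[0,T']`, `T' < T` (load-bearing:
`Negative.circuitTrace_false_without_apriori`). -/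
structure IsSol (lam : ℝ) {m : ℕ} (coeff : Fin m → Fin m → Fin m → Option (Fin 3) → ℝ) (T : ℝ)
    (X : Fin m → ℤ → ℝ → ℝ) : Prop where
  cont : ∀ (i : Fin m) (n : ℤ), ContinuousOn (X i n) (Set.Ico 0 T)
  ode : ∀ (i : Fin m) (n : ℤ), ∀ t ∈ Set.Ioo 0 T, HasDerivAt (X i n) (circuitRHS lam coeff X i n t) t
  cutoff : ∀ (i : Fin m) (n : ℤ) (t : ℝ), n < 0 → X i n t = 0
  apriori : ∀ T' ∈ Set.Ioo 0 T, ∃ C : ℝ, ∀ (i : Fin m) (n : ℤ), ∀ t ∈ Set.Icc 0 T',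
    lam ^ ((4 : ℝ) * n) * |X i n t| ≤ C

/-- Critical (scale-invariant) amplitude modulus of mode `i` at scale `n`: `a_{i,n}(t) = lam^{n/5}|X_{i,n}(t)|`
(verbatim the base of the crux's `ℓ³` summand). -/
def amp (lam : ℝ) {m : ℕ} (X : Fin m → ℤ → ℝ → ℝ) (i : Fin m) (n : ℤ) (t : ℝ) : ℝ :=
  lam ^ ((1 / 5 : ℝ) * n) * |X i n t|

/-- `ℓ^∞`-IN-SCALE critical bound (the Type-I tier): `a_{i,n}(t) ≤ A` for all modes, scales and `t ∈ [0,T)`. -/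
def SupCritBound (lam : ℝ) {m : ℕ} (T A : ℝ) (X : Fin m → ℤ → ℝ → ℝ) : Prop :=
  ∀ t ∈ Set.Ico 0 T, ∀ (i : Fin m) (n : ℤ), amp lam X i n t ≤ A

/-- The crux's `ℓ³`-IN-SCALE critical bound `sup_t Σ_{n,i} a_{i,n}(t)³ ≤ M` (finite partial sums),
definitionally the crux's hypothesis. -/
def L3Bound (lam : ℝ) {m : ℕ} (T M : ℝ) (X : Fin m → ℤ → ℝ → ℝ) : Prop :=
  ∀ t ∈ Set.Ico 0 T, ∀ s : Finset ℤ, ∑ n ∈ s, ∑ i : Fin m, (amp lam X i n t) ^ 3 ≤ M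

/-- The crux's conclusion: `H¹⁰`-boundedness up to `T`, `sup_{[0,T)} lam^{4n}|X_{i,n}| < ∞` (verbatim). -/
def Regular (lam : ℝ) {m : ℕ} (T : ℝ) (X : Fin m → ℤ → ℝ → ℝ) : Prop :=
  ∃ C : ℝ, ∀ (i : Fin m) (n : ℤ), ∀ t ∈ Set.Ico 0 T, lam ^ ((4 : ℝ) * n) * |X i n t| ≤ C

/-- Energy of the block strictly above the cut `g`: `E_{>g}(t) = Σ_{k ≥ 0} Σ_i X_{i,g+1+k}(t)²`. -/
def tailEnergy {m : ℕ} (X : Fin m → ℤ → ℝ → ℝ) (g : ℤ) (t : ℝ) : ℝ :=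
  ∑' k : ℕ, ∑ i : Fin m, (X i (g + 1 + k) t) ^ 2

/-- Dissipation of the block strictly above `g`: `D_{>g}(t) = Σ_{k ≥ 0} Σ_i lam^{4(g+1+k)/5} X_{i,g+1+k}(t)²`. -/
def tailDiss (lam : ℝ) {m : ℕ} (X : Fin m → ℤ → ℝ → ℝ) (g : ℤ) (t : ℝ) : ℝ :=
  ∑' k : ℕ, ∑ i : Fin m, lam ^ ((4 / 5 : ℝ) * ((g + 1 + k : ℤ) : ℝ)) * (X i (g + 1 + k) t) ^ 2

/-- The VALVE FLUX through the cut `g | g+1`: the `e₃ = (0,0,1)` (label `some 2`) interactions with base scale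
`g`, `lam^g Σ coeff(i₁,i₂,i₃,e₃) X_{i₁,g} X_{i₂,g} X_{i₃,g+1}` — in critical units `≤ K m² lam^{2g/5-1/5} a_g² a_{g+1}`,
QUADRATIC in the valve amplitude `a_g`. -/
def valveFlux (lam : ℝ) {m : ℕ} (coeff : Fin m → Fin m → Fin m → Option (Fin 3) → ℝ)
    (X : Fin m → ℤ → ℝ → ℝ) (g : ℤ) (t : ℝ) : ℝ :=
  lam ^ (g : ℝ) * ∑ i₁ : Fin m, ∑ i₂ : Fin m, ∑ i₃ : Fin m,
    coeff i₁ i₂ i₃ (some 2) * X i₁ g t * X i₂ g t * X i₃ (g + 1) t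

/-- The valve-flux identity FOR ONE SOLUTION: for every cut `g ≥ 0` and `t ∈ (0,T)`,
`d/dt E_{>g} = -2 D_{>g} + 2 · valveFlux_g`. (Asserted for every solution by stub S1 `ValveFlux`; taken as a
hypothesis by stub S3 `ValveBudget`.) -/
def HasValveFlux (lam : ℝ) {m : ℕ} (coeff : Fin m → Fin m → Fin m → Option (Fin 3) → ℝ) (T : ℝ)
    (X : Fin m → ℤ → ℝ → ℝ) : Prop :=
  ∀ g : ℤ, 0 ≤ g → ∀ t ∈ Set.Ioo 0 T,
    HasDerivAt (tailEnergy X g) (-2 * tailDiss lam X g t + 2 * valveFlux lam coeff X g t) t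

/-! ## The four registered stubs (statements as named `Prop`s; the `stub_*` bodies are `sorry`) -/

/-- **S1 — VALVE LAW / triad flux identity** (card K2 `flux_through_cut`, Ideator3 `TriadFlux`; F2 of the
Disproof). For every admissible circuit (cyclic cancellation suffices — symmetry (4.2) is not needed) and every
solution in the crux's class, the energy of the block above any cut `g ≥ 0` is differentiable on `(0,T)` with
derivative `−2·D_{>g} + 2·lam^g Σ coeff(·,·,·,some 2) X_g X_g X_{g+1}`: the triads `{b,b,b}` and `{b,b,b+1}`,
`b ≥ g+1`, lie inside the block and cancel orbit by orbit (`trilinear_cancel`), the triad `{g,g,g+1}` keeps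
only its `e₃` member. Termwise differentiation of the series is licensed by the a-priori `H¹⁰` bound on a
neighbourhood `[0,T'] ∋ t`. Why plausibly true: exact identity, checked to `1e-16` on random admissible
circuits by all three triagers; sign/homogeneity re-derived by hand (r1-2, r1-3). Size M–L (series bookkeeping). -/
def ValveFlux : Prop :=
  ∀ lam : ℝ, 1 < lam → ∀ (m : ℕ) (coeff : Fin m → Fin m → Fin m → Option (Fin 3) → ℝ), IsCyclic coeff →
    ∀ (T : ℝ) (X : Fin m → ℤ → ℝ → ℝ), 0 < T → IsSol lam coeff T X → HasValveFlux lam coeff T X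

/-- **S2 — QUIET BLOCK ⇒ REGULAR** (card links (i)+(ii), Ideator3 `QuietBlockRegular`; F3 of the Disproof),
under the `ℓ^∞` bound only. There is `δ₁ = δ₁(lam,m,coeff) > 0` such that: if the valve scale `g ≥ 0` is
`δ₁`-quiet on `[t₁,T)` and every scale above `g` is `δ₁`-quiet at the instant `t₁ ∈ (0,T)`, then the crux's
conclusion holds. Proof shape: (MP1) the block above `g` stays `δ₁`-quiet (at the arg-max scale `k > g`,
`da_k/dτ ≤ −a_k + 3Km² a_k · max(a, δ₁) < 0` once `4Km²δ₁ lam^{16/5} < 1`; the sup is a max by the a-priori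
bound); (MP2) the weighted block sup `sup_{k>g} lam^{4k}|X_k|` obeys a maximum principle modulo the bounded
boundary forcing `K lam^{4(g+1)} lam^{3g/5} δ₁²` from the valve, then one Duhamel step; scales `≤ g` are finitely
many and bounded by `A lam^{-j/5}` (`SupCritBound`), scales `< 0` vanish. Why plausibly true: both maximum
principles re-derived by the three triagers (toy: all-cold data never heats, `(da*/dτ)/a* ≤ −0.968`). Size M. -/
def QuietBlockRegular : Prop :=
  ∀ lam : ℝ, 1 < lam → ∀ (m : ℕ) (coeff : Fin m → Fin m → Fin m → Option (Fin 3) → ℝ), IsCyclic coeff →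
    ∃ δ₁ : ℝ, 0 < δ₁ ∧ ∀ (A T : ℝ) (X : Fin m → ℤ → ℝ → ℝ), 0 < T → IsSol lam coeff T X →
      SupCritBound lam T A X → ∀ g : ℤ, 0 ≤ g → ∀ t₁ ∈ Set.Ioo 0 T,
        (∀ i : Fin m, ∀ t ∈ Set.Ico t₁ T, amp lam X i g t ≤ δ₁) →
        (∀ (i : Fin m) (j : ℤ), g < j → amp lam X i j t₁ ≤ δ₁) →
        Regular lam T X

/-- **S3 — STARVED-VALVE BUDGET** (card K1's energy budget, links (iii)+(v), in the valve packaging of Ideator3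
`ValveBudget`; F2 "funding" of the Disproof), under the `ℓ^∞` bound and GIVEN the valve-flux identity for the
solution at hand. There are `δ₀ = δ₀(lam,m,coeff) > 0` and `C_b = C_b(lam,m) ≥ 0` such that for `0 < δ ≤ δ₀`:
if the valve `g ≥ 0` is `δ`-quiet on `[t₁,t₂] ⊂ (0,T)` while at every instant of `[t₁,t₂]` some mode at some
scale `> g` is `δ`-active, then `δ² lam^{4g/5} (t₂ − t₁) ≤ C_b A²`. Proof shape: `ℰ := lam^{2(g+1)/5} E_{>g}
≤ m A²/(1 − lam^{-2/5})`; per valve-clock unit `dℰ/dτ ≤ −2Σ_i a²_{i,g+1} − 2·lam^{2/5}δ²·[active scale ≥ g+2]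
+ 2Km²lam^{-3/5}δ² Σ_i a_{i,g+1} ≤ −δ²/2` for `δ ≤ δ₀` (the leak through the quiet valve is absorbed by
`a_{g+1}`'s own dissipation: `−2a² + 2cδ²a ≤ −a² + c²δ⁴`); integrate (`ℰ ≥ 0`); `lam^{4g/5} ≤ lam^{4(g+1)/5}`.
`D_{>g} ≥` (one term) needs summability, from `IsSol.apriori`. Why plausibly true: two-case inequality
re-derived by all triagers (toy: worst `dℰ/dτ = −2.89 δ²`, 0 violations). Size M. -/
def ValveBudget : Prop :=
  ∀ lam : ℝ, 1 < lam → ∀ (m : ℕ) (coeff : Fin m → Fin m → Fin m → Option (Fin 3) → ℝ), IsCyclic coeff →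
    ∃ δ₀ Cb : ℝ, 0 < δ₀ ∧ 0 ≤ Cb ∧ ∀ δ : ℝ, 0 < δ → δ ≤ δ₀ →
      ∀ (A T : ℝ) (X : Fin m → ℤ → ℝ → ℝ), 0 < T → IsSol lam coeff T X → SupCritBound lam T A X →
        HasValveFlux lam coeff T X → ∀ g : ℤ, 0 ≤ g → ∀ t₁ t₂ : ℝ, 0 < t₁ → t₁ ≤ t₂ → t₂ < T →
          (∀ i : Fin m, ∀ t ∈ Set.Icc t₁ t₂, amp lam X i g t ≤ δ) →
          (∀ t ∈ Set.Icc t₁ t₂, ∃ (i : Fin m) (j : ℤ), g < j ∧ δ ≤ amp lam X i j t) →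
          δ ^ 2 * lam ^ ((4 / 5 : ℝ) * g) * (t₂ - t₁) ≤ Cb * A ^ 2

/-- **S4 — LATE ACTIVITY IS EVENTUALLY ABSENT** (the `ℓ³` ENDGAME; corollary of Ideator3 `LateActivitySparse`
= card `clock-discounted-trail-mass`, equivalently of `tilted-trace-gronwall`'s terminal-trace endgame; F1
one-sided coupling of the Disproof, `block_backward_gronwall` in critical units). Under the crux's `ℓ³` bound:
for every threshold `δ > 0` and horizon `D ≥ 0` there is a scale `g₀` beyond which NO mode is `δ`-active within
`D` units of its own clock before `T`. Proof shape (Ideator3): the clock-discounted trail mass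
`H_j = Σ_{n ≤ j} lam^{θ(n−j)} |a_n|³` obeys the one-sided Grönwall `H_j(t) ≥ e^{−L lam^{4j/5}(t−s)} H_j(s)`
(every monomial of `Ẋ_n` has a factor at a scale `≤ n`; rates on the half-line `≤ lam^{4j/5}`; Young 3/2–3;
no symmetry/cancellation needed), so each late-active scale deposits `≥ e^{−LD}δ³` into `Σ_j H_j(t*) ≤
M/(1 − lam^{−θ})` at one common time `t* < T`: at most `N(lam,m,coeff,M,δ,D)` such scales; take `g₀` above them.
This is the ONLY stub using `q = 3 < ∞` (fails at `q = ∞`, as the Type-I facet requires). Why plausibly true: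
`TraceInequality` re-derived by all triagers (toy: worst own-clock depletion rate 3.1–7.7 ≪ crude `L`), counting
checked incl. `m = 0`, `M < 0` corners. Size L — HARDEST stub of the line. -/
def SparseLateActivity : Prop :=
  ∀ lam : ℝ, 1 < lam → ∀ (m : ℕ) (coeff : Fin m → Fin m → Fin m → Option (Fin 3) → ℝ), IsCyclic coeff →
    ∀ (M T : ℝ) (X : Fin m → ℤ → ℝ → ℝ), 0 < T → IsSol lam coeff T X → L3Bound lam T M X →
      ∀ δ : ℝ, 0 < δ → ∀ D : ℝ, 0 ≤ D → ∃ g₀ : ℤ, 0 ≤ g₀ ∧ ∀ g : ℤ, g₀ ≤ g →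
        ∀ i : Fin m, ∀ s ∈ Set.Ioo 0 T, T - s ≤ D * lam ^ (-((4 / 5 : ℝ) * g)) → amp lam X i g s < δ

theorem stub_valveFlux : ValveFlux := by
  sorry

theorem stub_quietBlockRegular : QuietBlockRegular := by
  sorry

theorem stub_valveBudget : ValveBudget := by
  sorry

theorem stub_sparseLateActivity : SparseLateActivity := by
  sorry

/-! ## The pace theorem (SYNCHRONY), proved from S1–S3 -/

/-- **SYNCHRONY / TYPE-I PACE AT EVERY LARGE SCALE** (the card's output `typeI_paced_fronts`, sharpened as the
triage asked: every large scale, `ℓ^∞` hypothesis only). For every admissible circuit there is a threshold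
`δ = δ(lam,m,coeff) > 0`, and for every amplitude bound `A` a horizon `D = D(lam,m,coeff,A)`, such that in ANY
solution of the crux's class with `sup a ≤ A` that blows up at `T` (i.e. is not `H¹⁰`-bounded up to `T`), every
sufficiently large scale `g` carries a `δ`-active mode at some time `s` with `T − s ≤ D·lam^{-4g/5}`: blow-up
under a critical `ℓ^∞` bound is at least Type-I-paced, at every scale. (A statement about the Type-I tier: it
is what a DSS pump `CircuitPump` does, and it is the reason `ℓ^q`-bounded blow-up, `q < ∞`, is impossible.) -/
def Synchrony : Prop :=
  ∀ lam : ℝ, 1 < lam → ∀ (m : ℕ) (coeff : Fin m → Fin m → Fin m → Option (Fin 3) → ℝ), IsCyclic coeff →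
    ∃ δ : ℝ, 0 < δ ∧ ∀ A : ℝ, ∃ D : ℝ, 0 ≤ D ∧ ∀ (T : ℝ) (X : Fin m → ℤ → ℝ → ℝ), 0 < T →
      IsSol lam coeff T X → SupCritBound lam T A X → ¬ Regular lam T X →
        ∃ g₀ : ℤ, 0 ≤ g₀ ∧ ∀ g : ℤ, g₀ ≤ g →
          ∃ i : Fin m, ∃ s ∈ Set.Ioo 0 T, T - s ≤ D * lam ^ (-((4 / 5 : ℝ) * g)) ∧ δ ≤ amp lam X i g s

/-- Own-clock windows shrink: for `lam > 1` and `D ≥ 0`, some scale `g₀ ≥ 0` has `D·lam^{-4g₀/5} < T`, and the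
window length is antitone in the scale. -/
theorem exists_window_lt {lam : ℝ} (hlam : 1 < lam) {D T : ℝ} (hD : 0 ≤ D) (hT : 0 < T) :
    ∃ g₀ : ℤ, 0 ≤ g₀ ∧ ∀ g : ℤ, g₀ ≤ g → D * lam ^ (-((4 / 5 : ℝ) * g)) < T := by
  have hlam0 : 0 < lam := by linarith
  -- r := lam^{-4/5} ∈ (0,1)
  set r : ℝ := lam ^ (-(4 / 5 : ℝ)) with hr
  have hr0 : 0 < r := Real.rpow_pos_of_pos hlam0 _
  have hr1 : r < 1 := Real.rpow_lt_one_of_one_lt_of_neg hlam (by norm_num)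
  have hpow : ∀ g : ℤ, lam ^ (-((4 / 5 : ℝ) * g)) = r ^ (g : ℝ) := by
    intro g
    rw [hr, ← Real.rpow_mul hlam0.le]
    congr 1
    ring
  obtain ⟨n, hn⟩ := exists_pow_lt_of_lt_one (show 0 < T / (D + 1) by positivity) hr1
  refine ⟨n, by exact_mod_cast Nat.zero_le n, fun g hg => ?_⟩
  have hmono : lam ^ (-((4 / 5 : ℝ) * g)) ≤ lam ^ (-((4 / 5 : ℝ) * (n : ℤ))) := by
    apply Real.rpow_le_rpow_of_exponent_le hlam.le
    have : ((n : ℤ) : ℝ) ≤ (g : ℝ) := by exact_mod_cast hg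
    linarith
  have hn' : lam ^ (-((4 / 5 : ℝ) * (n : ℤ))) = r ^ n := by
    rw [hpow]
    simp [Real.rpow_natCast]
  have hDT : D * (T / (D + 1)) < T := by
    have hD1 : (0 : ℝ) < D + 1 := by linarith
    have hlt : D / (D + 1) < 1 := by rw [div_lt_one hD1]; linarith
    calc D * (T / (D + 1)) = D / (D + 1) * T := by ring
      _ < 1 * T := mul_lt_mul_of_pos_right hlt hT
      _ = T := one_mul T
  calc D * lam ^ (-((4 / 5 : ℝ) * g)) ≤ D * lam ^ (-((4 / 5 : ℝ) * (n : ℤ))) :=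
        mul_le_mul_of_nonneg_left hmono hD
    _ = D * r ^ n := by rw [hn']
    _ ≤ D * (T / (D + 1)) := mul_le_mul_of_nonneg_left hn.le hD
    _ < T := hDT

/-- **Composition I (real proof): S2 → S1 → S3 → SYNCHRONY.** Fix `δ := min δ₀ δ₁`, `D := 2C_bA²/δ² + 2`.
If a large scale `g` (window `w := D lam^{-4g/5} < T`) had no `δ`-exceedance on `[T − w, T)`, the valve `g` is
quiet there ("policing" for free); either every scale above `g` is `δ`-quiet at some instant `t' ∈ [T−w,T)` —
then S2 makes the solution regular, contradiction — or at every instant some scale above `g` is `δ`-active, and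
S3 on `[T − w, T − w/2]` gives `δ² lam^{4g/5} · w/2 ≤ C_b A²`, i.e. `C_b A² + δ² ≤ C_b A²`: contradiction. -/
theorem synchrony_of_parts (hQ : QuietBlockRegular) (hF : ValveFlux) (hB : ValveBudget) : Synchrony := by
  intro lam hlam m coeff hcyc
  obtain ⟨δ₁, hδ₁, hQ'⟩ := hQ lam hlam m coeff hcyc
  obtain ⟨δ₀, Cb, hδ₀, hCb, hB'⟩ := hB lam hlam m coeff hcyc
  have hlam0 : 0 < lam := by linarith
  set δ : ℝ := min δ₀ δ₁ with hδdef
  have hδ : 0 < δ := lt_min hδ₀ hδ₁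
  have hδle₀ : δ ≤ δ₀ := min_le_left _ _
  have hδle₁ : δ ≤ δ₁ := min_le_right _ _
  refine ⟨δ, hδ, fun A => ?_⟩
  set D : ℝ := 2 * Cb * A ^ 2 / δ ^ 2 + 2 with hDdef
  have hD0 : 0 ≤ D := by
    have : 0 ≤ 2 * Cb * A ^ 2 / δ ^ 2 := by positivity
    rw [hDdef]; linarith
  refine ⟨D, hD0, fun T X hT hsol hA hnreg => ?_⟩
  obtain ⟨g₀, hg₀, hwin⟩ := exists_window_lt hlam hD0 hT
  refine ⟨g₀, hg₀, fun g hg => ?_⟩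
  have hg0 : 0 ≤ g := le_trans hg₀ hg
  -- the final window of scale g
  set w : ℝ := D * lam ^ (-((4 / 5 : ℝ) * g)) with hwdef
  have hpow0 : 0 < lam ^ (-((4 / 5 : ℝ) * g)) := Real.rpow_pos_of_pos hlam0 _
  have hwT : w < T := hwin g hg
  have hw0 : 0 < w := by
    have : (0 : ℝ) < 2 := by norm_num
    have hD2 : 2 ≤ D := by
      have : 0 ≤ 2 * Cb * A ^ 2 / δ ^ 2 := by positivity
      rw [hDdef]; linarith
    rw [hwdef]; positivity
  by_contra hno
  push Not at hno
  -- hno : ∀ i, ∀ s ∈ Ioo 0 T, T - s ≤ w → amp lam X i g s < δ   (the valve g is δ-quiet on [T-w, T))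
  set t₁ : ℝ := T - w with ht₁def
  have ht₁0 : 0 < t₁ := by rw [ht₁def]; linarith
  have ht₁T : t₁ < T := by rw [ht₁def]; linarith
  have hvalve : ∀ i : Fin m, ∀ t ∈ Set.Ico t₁ T, amp lam X i g t < δ := by
    intro i t ht
    refine hno i t ⟨lt_of_lt_of_le ht₁0 ht.1, ht.2⟩ ?_
    have := ht.1; rw [ht₁def] at this; linarith
  by_cases hcase : ∃ t' ∈ Set.Ico t₁ T, ∀ (i : Fin m) (j : ℤ), g < j → amp lam X i j t' ≤ δ
  · -- Case A: the block above g is δ-quiet at some instant t' of the window ⇒ regular (S2)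
    obtain ⟨t', ht', hblock⟩ := hcase
    have ht'0 : 0 < t' := lt_of_lt_of_le ht₁0 ht'.1
    refine hnreg (hQ' A T X hT hsol hA g hg0 t' ⟨ht'0, ht'.2⟩ ?_ ?_)
    · intro i t ht
      exact le_trans (hvalve i t ⟨le_trans ht'.1 ht.1, ht.2⟩).le hδle₁
    · intro i j hj
      exact le_trans (hblock i j hj) hδle₁
  · -- Case B: at every instant of the window some scale above g is δ-active ⇒ budget (S3) on [t₁, T - w/2]
    push Not at hcase
    set t₂ : ℝ := T - w / 2 with ht₂def
    have ht₁₂ : t₁ ≤ t₂ := by rw [ht₁def, ht₂def]; linarith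
    have ht₂T : t₂ < T := by rw [ht₂def]; linarith
    have hbud := hB' δ hδ hδle₀ A T X hT hsol hA (hF lam hlam m coeff hcyc T X hT hsol) g hg0 t₁ t₂
      ht₁0 ht₁₂ ht₂T
      (fun i t ht => (hvalve i t ⟨ht.1, lt_of_le_of_lt ht.2 ht₂T⟩).le)
      (fun t ht => by
        obtain ⟨i, j, hj, hlt⟩ := hcase t ⟨ht.1, lt_of_le_of_lt ht.2 ht₂T⟩
        exact ⟨i, j, hj, hlt.le⟩)
    -- the window algebra: t₂ - t₁ = w/2 = (Cb A²/δ² + 1) lam^{-4g/5}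
    have hlen : t₂ - t₁ = (Cb * A ^ 2 / δ ^ 2 + 1) * lam ^ (-((4 / 5 : ℝ) * g)) := by
      rw [ht₂def, ht₁def, hwdef, hDdef]; ring
    have hcancel : lam ^ ((4 / 5 : ℝ) * g) * lam ^ (-((4 / 5 : ℝ) * g)) = 1 := by
      rw [Real.rpow_neg hlam0.le, mul_inv_cancel₀ (Real.rpow_pos_of_pos hlam0 _).ne']
    have hval : δ ^ 2 * lam ^ ((4 / 5 : ℝ) * g) * (t₂ - t₁) = Cb * A ^ 2 + δ ^ 2 := by
      rw [hlen]
      have hδ2 : δ ^ 2 ≠ 0 := by positivity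
      calc δ ^ 2 * lam ^ ((4 / 5 : ℝ) * g) * ((Cb * A ^ 2 / δ ^ 2 + 1) * lam ^ (-((4 / 5 : ℝ) * g)))
          = δ ^ 2 * (Cb * A ^ 2 / δ ^ 2 + 1) * (lam ^ ((4 / 5 : ℝ) * g) * lam ^ (-((4 / 5 : ℝ) * g))) := by
            ring
        _ = Cb * A ^ 2 * (δ ^ 2 / δ ^ 2) + δ ^ 2 := by rw [hcancel]; ring
        _ = Cb * A ^ 2 + δ ^ 2 := by rw [div_self hδ2, mul_one]
    rw [hval] at hbud
    have : 0 < δ ^ 2 := by positivity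
    linarith

/-! ## Composition II (real proof): SYNCHRONY ⊕ SPARSITY ⇒ the crux -/

/-- From the crux's finite-sum `ℓ³` bound, the `ℓ^∞` bound with `A = max M 1`. -/
theorem supCritBound_of_l3 {lam : ℝ} (hlam : 1 < lam) {m : ℕ} {T M : ℝ} {X : Fin m → ℤ → ℝ → ℝ}
    (hM : L3Bound lam T M X) : SupCritBound lam T (max M 1) X := by
  intro t ht i n
  have hlam0 : 0 < lam := by linarith
  have h1 := hM t ht {n}
  rw [Finset.sum_singleton] at h1
  have h0 : ∀ j : Fin m, 0 ≤ amp lam X j n t := fun j => by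
    unfold amp; positivity
  have h2 : (amp lam X i n t) ^ 3 ≤ M :=
    le_trans (Finset.single_le_sum (f := fun i => (amp lam X i n t) ^ 3)
      (fun j _ => pow_nonneg (h0 j) 3) (Finset.mem_univ i)) h1
  by_contra hlt
  have hlt' := not_le.mp hlt
  set x := amp lam X i n t with hx
  have h3 : 1 ≤ x := (lt_of_le_of_lt (le_max_right _ _) hlt').le
  have h4 : M < x := lt_of_le_of_lt (le_max_left _ _) hlt'
  have hx0 : 0 ≤ x := h0 i
  have h5 : x ≤ x ^ 3 :=
    calc x = x * 1 * 1 := by ring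
      _ ≤ x * x * x := by gcongr
      _ = x ^ 3 := by ring
  linarith

/-- **Composition II (real proof): `Synchrony → SparseLateActivity → CircuitTrace'`.** Suppose the conclusion
fails. With `A := max M 1` (`supCritBound_of_l3`) SYNCHRONY gives `δ, D, g₀` such that every scale `g ≥ g₀` is
`δ`-active within `D` own-clock units of `T`; SPARSITY (the `ℓ³` endgame) gives `g₀'` beyond which no scale is;
the scale `max g₀ g₀'` is both — contradiction. -/
theorem circuitTrace_of_parts (hS : Synchrony) (hL : SparseLateActivity) : CircuitTrace' := by
  intro lam hlam m coeff _hsym hcyc T hT X hcont hode hcut hapr hM3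
  obtain ⟨M, hM⟩ := hM3
  have hsol : IsSol lam coeff T X := ⟨hcont, hode, hcut, hapr⟩
  have hL3 : L3Bound lam T M X := hM
  have hA : SupCritBound lam T (max M 1) X := supCritBound_of_l3 hlam hL3
  by_contra hnreg
  have hnreg' : ¬ Regular lam T X := hnreg
  obtain ⟨δ, hδ, hSA⟩ := hS lam hlam m coeff hcyc
  obtain ⟨D, hD, hSD⟩ := hSA (max M 1)
  obtain ⟨g₀, hg₀, hsync⟩ := hSD T X hT hsol hA hnreg'
  obtain ⟨g₁, hg₁, hquiet⟩ := hL lam hlam m coeff hcyc M T X hT hsol hL3 δ hδ D hD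
  obtain ⟨i, s, hs, hwin, hact⟩ := hsync (max g₀ g₁) (le_max_left _ _)
  have hlt := hquiet (max g₀ g₁) (le_max_right _ _) i s hs hwin
  linarith

/-- **The skeleton concludes the crux BY NAME** (the `#h21_check_skeleton` theorem): the four registered stubs,
fed to the two sorry-free compositions, give
`Summit.NavierStokesRegularity.NavierStokesRegularity.Theses.PerpetualPump.CircuitTrace`. No `sorry` of its own;
its axiom closure contains `sorryAx` exactly through the four `stub_*` (closed once they land). -/
theorem CircuitTrace_of : CircuitTrace :=
  circuitTrace_iff.mpr
    (circuitTrace_of_parts (synchrony_of_parts stub_quietBlockRegular stub_valveFlux stub_valveBudget)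
      stub_sparseLateActivity)

end Summit.NavierStokesRegularity.NavierStokesRegularity.Cruxes.CircuitTrace.ColdGapStarvation

end
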